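import Literature.NumberTheory.ConnesConsani2021.SeriesRemainderProlateDatum
import Literature.NumberTheory.LFunctions.ProlateEndpointBound
import HarnessLib

/-!
# Connes–Consani 2021, App. F without the Rokhlin–Xiao input (100): Lemma F.1 from the §4 facts alone

RH-FREE corpus literature (label, line 1): real analysis of prolate spheroidal wave functions at
bandwidth `2π`; nothing here mentions `ζ`, the critical strip or RH, and nothing here bears on the truth
of RH.  bears_on (cell rh-crit, corpus C1): apex input (B) / route binder K0 (`DensityRegular`).

A. Connes, C. Consani, *Weil positivity and trace formula, the archimedean place*, Selecta Math. 27
(2021) 77 = arXiv:2006.13771 [bib `ConnesConsani2021`], App. F «Issues of convergence» (Lemma F.1 =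
arXiv Lemma 49) bounds the boundary terms `B_n(ρ)` of `τ(n)T_n(ρ)` through the inequality (Rokh)
= (100) = [Rokhlin–Xiao 2007, Thm. 12] `|ξ_n(1)| ≤ (2n+½)^{1/2}` (arXiv chunk p0035:L70).  That inequality
is STATED WITHOUT PROOF in its source ("listed without proofs", Appl. Comput. Harmon. Anal. 22 (2007)
p. 116) and is, according to [Bonami–Karoui 2014, p. 230], "frequently cited (but not proved) in the
literature … an analytic proof seems to be difficult to obtain".  `SeriesRemainderBounds.lean` therefore
carries it as the HYPOTHESIS field `IsAppEProlateDatum.abs_apply_one_lt`.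

THIS FILE shows that App. F does not need it: the closing arithmetic of Lemma F.1 (i) (with the printed
majorant `a(n)`) has slack quadratic in `n` in its `A_n`-part, and the ELEMENTARY endpoint bound
`ψ(1)² ≤ (27/4)(χ + 4π²)` of [Bonami–Karoui 2014] (tree: `IsProlateFunction.sq_apply_one_le`, file
`LFunctions/ProlateEndpointBound.lean`, valid for `χ > 4π²`, i.e. every `n ≥ 3`) is linear in `n`.

* `IsAppFDatum n ψ lam χ` — the App. F datum with ONLY the §4 inputs as fields: `ψ = h_{2n,1}` with
  eigenvalue `χ`, (cosalphan) `η̃ = λψ` on `[−1,1]`, (chirem0.5) `λ² < 1`, (rapid-decay) `|λ| ≤ r(n)`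
  (`IsAppEProlateDatum` minus the fields `abs_apply_one_lt` [RX07 Thm 12], `eigen_gt`, `eigen_lt`,
  `wang` — the last three are THEOREMS since `Wang2010_lemma_2_2_holds`, `Wang2010_thm_3_6_holds`);
  `IsAppEProlateDatum.toF`.
* `IsAppFDatum.abs_sonineQTerm_le` — **Lemma F.1 termwise, PROVED**: `|τ(n)T_n(ρ)| ≤ a(n)` for
  `n ≥ 3`, `ρ ∈ [1,2]` (same chain as `CC2021_lemma_49_termwise_holds`, with the boundary terms bounded
  through `|ψ(1)| ≤ ((27/4)(2n(2n+1) + 8π²))^{1/2} ≤ 6n + 12` instead of `(2n+½)^{1/2}`: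
  `termwise_arith_F`).
* `lemma_49_i_F`, `lemma_49_ii_F` — (computersafe) (`N ≥ 2`) and (computersafe1)
  (`≤ 2.366·10^{-12}`, the kernel-certified number `CC2021_lemma_49_ii_tail_holds`) for `IsAppFDatum` data.
* `exists_isAppFDatum_prolateFun`, `lemma_49_i_prolateFun_rokhlinFree`, `lemma_49_ii_prolateFun_rokhlinFree`
  — App. F Lemma F.1 (i)(ii) for THE prolate sequence `(prolateFun n, prolateEigen n)` of §4, conditional
  on the three §4 named facts `CC2021_sec4_cosalphan`, `CC2021_sec4_lambda_basic`,
  `CC2021_sec4_rapidDecay` of `ProlateProjections.lean` AND NOTHING ELSE.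

No new named fact; one new structure (a weakening of `IsAppEProlateDatum`).  The lemmas
`lam_mul_derivWithin_F`, `abs_lam_le_const_F`, `abs_integralTerm_le_F` repeat the proofs of their
`IsAppEProlateDatum` namesakes verbatim for the weaker structure (the landed statements are not edited).

## References

* [cite: ConnesConsani2021, App. F Lemma F.1 (arXiv Lemma 49), arXiv PDF p. 55 (chunk p0035:L5–L110)]
* [cite: BonamiKaroui2014, Thm. 2.1, eq. (13), Thm. 3.1; p. 230 on (100)]
* [cite: RokhlinXiao2007, Thm. 12 p. 116 ("listed without proofs")]
-/

noncomputable section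

open Real MeasureTheory Set Filter intervalIntegral
open scoped Nat Topology

namespace Literature.NumberTheory.ConnesConsani2021

open Literature.NumberTheory.LFunctions

/-! ## The App. F datum with the §4 inputs only -/

/-- RH-FREE. **The App. F datum, §4 inputs only**: a tree prolate function `ψ = h_{2n,1}` (bandwidth
`2π`, `∫_{-1}^1 ψ² = 1`, `2n` zeros) with eigenvalue `χ`, a real `λ` with (cosalphan) `η̃ = λψ` on
`[−1,1]` (`η̃ = cosTransform ψ`), (chirem0.5) `λ² < 1` and (rapid-decay) `|λ| ≤ r(n)`
(p0016:L36, [Rokhlin–Xiao 2007, Thm 14] as used by CC for every `n`).  Compared with `IsAppEProlateDatum`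
the [Wang 2010] inputs (now theorems) and the [Rokhlin–Xiao 2007, Thm 12] input (100) (unproved in print)
are omitted. [cite: ConnesConsani2021, §4 Prop. 4.5 (i) (arXiv item 25, chunk p0016:L36–L50); App. F (chunk p0035:L7–L20)] -/
structure IsAppFDatum (n : ℕ) (ψ : ℝ → ℝ) (lam χ : ℝ) : Prop where
  isProlate : IsProlateFunction 1 (2 * n) ψ
  eigen : ∀ x ∈ Ioo (-1 : ℝ) 1,
    -(deriv (fun y ↦ (1 ^ 2 - y ^ 2) * deriv ψ y) x) + (2 * π * 1 * x) ^ 2 * ψ x = χ * ψ x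
  cosTransform_eq : ∀ x ∈ Icc (-1 : ℝ) 1, cosTransform ψ x = lam * ψ x
  sq_lam_lt : lam ^ 2 < 1
  abs_lam_le : |lam| ≤ 2 ^ (2 * n) * π ^ (2 * n) * Real.sqrt π * ((2 * n)! : ℝ) ^ 2
    / ((4 * n)! * Real.Gamma (2 * n + 3 / 2))

/-- RH-FREE. The §4-only datum is a weakening of the App. F datum of `SeriesRemainderBounds.lean`.
[cite: ConnesConsani2021, App. F (chunk p0035:L7–L20)] -/
theorem IsAppEProlateDatum.toF {n : ℕ} {ψ : ℝ → ℝ} {lam χ : ℝ} (d : IsAppEProlateDatum n ψ lam χ) :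
    IsAppFDatum n ψ lam χ :=
  { isProlate := d.isProlate
    eigen := d.eigen
    cosTransform_eq := d.cosTransform_eq
    sq_lam_lt := d.sq_lam_lt
    abs_lam_le := d.abs_lam_le }

namespace IsAppFDatum

variable {n : ℕ} {ψ : ℝ → ℝ} {lam χ : ℝ}

/-- RH-FREE. [Wang 2010, Lemma 2.2] for the datum (a theorem: `Wang2010_lemma_2_2_holds`):
`2n(2n+1) < χ`. [cite: WangLL2010, Lemma 2.2 eq. (2.6) p. 809] -/
theorem eigen_gt (d : IsAppFDatum n ψ lam χ) : 2 * (n : ℝ) * (2 * n + 1) < χ :=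
  (IsAppEProlateDatum.wang_inputs d.isProlate d.eigen).1.1

/-- RH-FREE. [Wang 2010, Lemma 2.2] for the datum: `χ < 2n(2n+1) + (2π)²`.
[cite: WangLL2010, Lemma 2.2 eq. (2.6) p. 809] -/
theorem eigen_lt (d : IsAppFDatum n ψ lam χ) : χ < 2 * (n : ℝ) * (2 * n + 1) + (2 * π) ^ 2 :=
  (IsAppEProlateDatum.wang_inputs d.isProlate d.eigen).1.2

/-- RH-FREE. [Wang 2010, Thm. 3.6 (3.43)] (boundWang) for the datum (a theorem: `Wang2010_thm_3_6_holds`).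
[cite: WangLL2010, Thm. 3.6 eq. (3.43) p. 820] -/
theorem wang (d : IsAppFDatum n ψ lam χ) :
    ∫ x in (-1 : ℝ)..1, ((1 - x ^ 2) * deriv (deriv ψ) x) ^ 2
      ≤ ((2 * (n : ℝ)) ^ 2 + (6 * π + 1) * (2 * n) + 3 * (2 * π + 1) ^ 2) ^ 2 :=
  (IsAppEProlateDatum.wang_inputs d.isProlate d.eigen).2

/-- RH-FREE. **The endpoint bound replacing (100)**: for `n ≥ 3`, `ψ(1)² ≤ (27/4)(χ + 4π²)`
([Bonami–Karoui 2014]; tree `IsProlateFunction.sq_apply_one_le`; `χ > 2n(2n+1) ≥ 42 > 4π²`).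
[cite: BonamiKaroui2014, Thm. 2.1, eq. (13), Thm. 3.1] -/
theorem sq_apply_one_le (d : IsAppFDatum n ψ lam χ) (hn : 3 ≤ n) :
    ψ 1 ^ 2 ≤ 27 / 4 * (χ + (2 * π) ^ 2) := by
  have hn' : (3 : ℝ) ≤ n := by exact_mod_cast hn
  have hc : (2 * π) ^ 2 < χ := by nlinarith [d.eigen_gt, Real.pi_lt_d2, Real.pi_pos]
  exact d.isProlate.sq_apply_one_le d.eigen hc

/-- RH-FREE. The endpoint bound in the polynomial form used below: `|ψ(1)|² ≤ (27/4)(2n(2n+1) + 8π²)`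
for `n ≥ 3`. [cite: BonamiKaroui2014, Thm. 3.1] -/
theorem abs_apply_one_sq_le (d : IsAppFDatum n ψ lam χ) (hn : 3 ≤ n) :
    |ψ 1| ^ 2 ≤ 27 / 4 * (2 * (n : ℝ) * (2 * n + 1) + 8 * π ^ 2) := by
  rw [sq_abs]
  have h1 := d.sq_apply_one_le hn
  nlinarith [d.eigen_lt]

/-- RH-FREE. **The proportionality step of App. F** (p0035:L59–L65) for the §4-only datum:
`λ · D⁺ψ = η̃′` on the closed interval (copy of `IsAppEProlateDatum.lam_mul_derivWithin`).
[cite: ConnesConsani2021, App. F, chunk p0035:L59–L65] -/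
theorem lam_mul_derivWithin_F (d : IsAppFDatum n ψ lam χ) {y : ℝ} (hy : y ∈ Icc (-1 : ℝ) 1) :
    lam * derivWithin ψ (Icc (-1) 1) y = deriv (cosTransform ψ) y := by
  have hU : UniqueDiffWithinAt ℝ (Icc (-1 : ℝ) 1) y := uniqueDiffOn_Icc (by norm_num) y hy
  have hψc : ContinuousOn ψ (Icc (-1) 1) := by simpa using d.isProlate.contDiffOn.continuousOn
  obtain ⟨hf, -, -, -, -⟩ := hasDerivWithinAt_package d.isProlate
  have hη := hasDerivAt_cosTransform hψc y
  rw [hη.deriv, ← hη.hasDerivWithinAt.derivWithin hU,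
    derivWithin_congr (fun x hx ↦ d.cosTransform_eq x hx) (d.cosTransform_eq y hy),
    derivWithin_const_mul lam (hf y hy).differentiableWithinAt]

/-- RH-FREE. `|λ(n)| ≤ r(n) ≤ r(3) ≤ 13/200` for `n ≥ 3`, hence `λ² ≤ 169/40000` (copy of
`IsAppEProlateDatum.abs_lam_le_const`). [cite: ConnesConsani2021, App. F, chunk p0035:L31; §4 p0016:L36] -/
theorem abs_lam_le_const_F (d : IsAppFDatum n ψ lam χ) (hn : 3 ≤ n) :
    |lam| ≤ remainderTerm n / (4 * π * remainderPoly n) ∧ lam ^ 2 ≤ 169 / 40000 := by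
  have hr : |lam| ≤ remainderTerm n / (4 * π * remainderPoly n) := by
    rw [← rapidDecay_eq]; exact d.abs_lam_le
  have hlam : |lam| ≤ 13 / 200 := (hr.trans (rapidDecay_le_three hn)).trans rapidDecay_three_le
  exact ⟨hr, by nlinarith [abs_nonneg lam, sq_abs lam]⟩

/-- RH-FREE. (boundAn) made quantitative for the §4-only datum (copy of
`IsAppEProlateDatum.abs_integralTerm_le`, with the [Wang] inputs supplied by the theorems): for
`ρ ∈ [1,2]`, `|√ρ ∫_{ρ⁻¹}^1 D_uψ · D_uη̃(ρ·)| ≤ (99/70)·(2K·(99/280)(W₀+χ))`, `K = 99π/35`.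
[cite: ConnesConsani2021, App. F eq. (boundAn), chunk p0035:L45] -/
theorem abs_integralTerm_le_F (d : IsAppFDatum n ψ lam χ) (hn : 3 ≤ n) {ρ : ℝ} (hρ1 : 1 ≤ ρ)
    (hρ2 : ρ ≤ 2) :
    |Real.sqrt ρ * ∫ x in ρ⁻¹..1, scaleDerivIn ψ x * scaleDeriv (cosTransform ψ) (ρ * x)|
      ≤ 99 / 70 * (2 * (99 * π / 35) * (99 / 280 *
        (((2 * (n : ℝ)) ^ 2 + (6 * π + 1) * (2 * n) + 3 * (2 * π + 1) ^ 2) + χ))) := by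
  obtain ⟨hf, hf', hf''c, e1, e2⟩ := hasDerivWithinAt_package d.isProlate
  have hψc : ContinuousOn ψ (Icc (-1) 1) := fun x hx ↦ (hf x hx).continuousWithinAt
  have hf'c : ContinuousOn (derivWithin ψ (Icc (-1) 1)) (Icc (-1) 1) :=
    fun x hx ↦ (hf' x hx).continuousWithinAt
  have hnorm : ∫ x in (-1 : ℝ)..1, ψ x ^ 2 = 1 := by simpa using d.isProlate.norm_one
  have hn' : (3 : ℝ) ≤ n := by exact_mod_cast hn
  have hπ := Real.pi_pos
  set W₀ : ℝ := (2 * (n : ℝ)) ^ 2 + (6 * π + 1) * (2 * n) + 3 * (2 * π + 1) ^ 2 with hW₀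
  set K : ℝ := 99 * π / 35 with hK
  have hW₀pos : 0 < W₀ := by rw [hW₀]; positivity
  have hχ4 : 4 * π ^ 2 ≤ χ := by nlinarith [d.eigen_gt, Real.pi_lt_d2]
  have hη' : ∀ y, |deriv (cosTransform ψ) y| ≤ K := fun y ↦ by
    rw [hK]; exact abs_deriv_cosTransform_le hψc hnorm y
  have hsρ : Real.sqrt ρ ≤ 99 / 70 := by
    rw [show (99 / 70 : ℝ) = Real.sqrt ((99 / 70) ^ 2) by rw [Real.sqrt_sq (by norm_num)]]
    exact Real.sqrt_le_sqrt (by nlinarith)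
  have hρ0 : 0 < ρ := by linarith
  have hρi1 : ρ⁻¹ ≤ 1 := inv_le_one_of_one_le₀ hρ1
  have hρi2 : 1 / 2 ≤ ρ⁻¹ := by rw [one_div]; exact inv_anti₀ hρ0 hρ2
  have hode := ode_Icc_of_eigen d.isProlate d.eigen
  have hwang' : ∫ x in (-1 : ℝ)..1,
      ((1 - x ^ 2) * derivWithin (derivWithin ψ (Icc (-1) 1)) (Icc (-1) 1) x) ^ 2 ≤ W₀ ^ 2 := by
    have hfull : ∫ x in (-1 : ℝ)..1,
          ((1 - x ^ 2) * derivWithin (derivWithin ψ (Icc (-1) 1)) (Icc (-1) 1) x) ^ 2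
        = ∫ x in (-1 : ℝ)..1, ((1 - x ^ 2) * deriv (deriv ψ) x) ^ 2 := by
      refine integral_congr_ae ?_
      have hae : ∀ᵐ x : ℝ, x ≠ 1 := by rw [ae_iff]; simp
      filter_upwards [hae] with x hx1 hx
      rw [uIoc_of_le (by norm_num)] at hx
      rw [e2 x ⟨hx.1, lt_of_le_of_ne hx.2 hx1⟩]
    rw [hfull, hW₀]; exact d.wang
  have hL1 := integral_abs_mul_deriv_le hψc hf'c hf''c hode hχ4 hW₀pos hwang' hnorm hρi2 hρi1
  rw [abs_mul, abs_of_nonneg (Real.sqrt_nonneg _)]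
  refine mul_le_mul hsρ ?_ (abs_nonneg _) (by norm_num)
  have hb : IntervalIntegrable (fun x ↦ 2 * K * |x * derivWithin ψ (Icc (-1) 1) x|) volume ρ⁻¹ 1 := by
    refine ((ContinuousOn.intervalIntegrable ?_).abs).const_mul _
    rw [uIcc_of_le hρi1]
    exact ContinuousOn.mul (by fun_prop) (hf'c.mono (Icc_subset_Icc (by linarith) le_rfl))
  calc |∫ x in ρ⁻¹..1, scaleDerivIn ψ x * scaleDeriv (cosTransform ψ) (ρ * x)|
      ≤ ∫ x in ρ⁻¹..1, 2 * K * |x * derivWithin ψ (Icc (-1) 1) x| := by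
        rw [← Real.norm_eq_abs]
        refine intervalIntegral.norm_integral_le_of_norm_le hρi1 ?_ hb
        refine Eventually.of_forall fun x hx ↦ ?_
        have hx0 : 0 ≤ x := le_trans (by positivity) hx.1.le
        have hρx : |ρ * x| ≤ 2 := by
          rw [abs_of_nonneg (by positivity)]; nlinarith [hx.2]
        rw [Real.norm_eq_abs, scaleDerivIn, scaleDeriv, abs_mul, abs_mul (ρ * x)]
        calc |x * derivWithin ψ (Icc (-1) 1) x| * (|ρ * x| * |deriv (cosTransform ψ) (ρ * x)|)
            ≤ |x * derivWithin ψ (Icc (-1) 1) x| * (2 * K) :=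
              mul_le_mul_of_nonneg_left (mul_le_mul hρx (hη' _) (abs_nonneg _) (by norm_num))
                (abs_nonneg _)
          _ = 2 * K * |x * derivWithin ψ (Icc (-1) 1) x| := by ring
    _ = 2 * K * ∫ x in ρ⁻¹..1, |x * derivWithin ψ (Icc (-1) 1) x| :=
        intervalIntegral.integral_const_mul _ _
    _ ≤ 2 * K * (99 / 280 * (W₀ + χ)) := mul_le_mul_of_nonneg_left hL1 (by positivity)

/-- RH-FREE. (boundBn) made quantitative WITHOUT (100): for `ρ ∈ [1,2]` and `K = 99π/35`,
`|ρ^{-1/2}D_uψ(ρ⁻¹)η̃(1)| ≤ K·|ψ(1)|` (proportionality step) and `|ρ^{1/2}ψ(1)D_uη̃(ρ)| ≤ (99/70)·|ψ(1)|·2K`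
— the endpoint value is left as `|ψ(1)|` (bounded separately by `abs_apply_one_sq_le`).
[cite: ConnesConsani2021, App. F eq. (boundBn), chunk p0035:L49–L74] -/
theorem abs_boundaryTerms_le_F (d : IsAppFDatum n ψ lam χ) {ρ : ℝ} (hρ1 : 1 ≤ ρ) (hρ2 : ρ ≤ 2) :
    |(Real.sqrt ρ)⁻¹ * scaleDerivIn ψ ρ⁻¹ * cosTransform ψ 1| ≤ 99 * π / 35 * |ψ 1| ∧
      |Real.sqrt ρ * ψ 1 * scaleDeriv (cosTransform ψ) ρ| ≤ 99 / 70 * |ψ 1| * (2 * (99 * π / 35)) := by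
  obtain ⟨hf, -, -, -, -⟩ := hasDerivWithinAt_package d.isProlate
  have hψc : ContinuousOn ψ (Icc (-1) 1) := fun x hx ↦ (hf x hx).continuousWithinAt
  have hnorm : ∫ x in (-1 : ℝ)..1, ψ x ^ 2 = 1 := by simpa using d.isProlate.norm_one
  have hπ := Real.pi_pos
  set K : ℝ := 99 * π / 35 with hK
  have hη' : ∀ y, |deriv (cosTransform ψ) y| ≤ K := fun y ↦ by
    rw [hK]; exact abs_deriv_cosTransform_le hψc hnorm y
  have hsρ : Real.sqrt ρ ≤ 99 / 70 := by
    rw [show (99 / 70 : ℝ) = Real.sqrt ((99 / 70) ^ 2) by rw [Real.sqrt_sq (by norm_num)]]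
    exact Real.sqrt_le_sqrt (by nlinarith)
  have hsρ1 : 1 ≤ Real.sqrt ρ := by
    rw [← Real.sqrt_one]; exact Real.sqrt_le_sqrt hρ1
  have hρ0 : 0 < ρ := by linarith
  have hρi1 : ρ⁻¹ ≤ 1 := inv_le_one_of_one_le₀ hρ1
  constructor
  · have hc1 : cosTransform ψ 1 = lam * ψ 1 := d.cosTransform_eq 1 (by norm_num)
    have hprop := d.lam_mul_derivWithin_F (y := ρ⁻¹) ⟨by linarith [inv_pos.2 hρ0], hρi1⟩
    have e : (Real.sqrt ρ)⁻¹ * scaleDerivIn ψ ρ⁻¹ * cosTransform ψ 1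
        = (Real.sqrt ρ)⁻¹ * ρ⁻¹ * deriv (cosTransform ψ) ρ⁻¹ * ψ 1 := by
      rw [hc1, scaleDerivIn, ← hprop]; ring
    rw [e, abs_mul, abs_mul, abs_mul, abs_of_pos (by positivity : (0 : ℝ) < (Real.sqrt ρ)⁻¹),
      abs_of_pos (by positivity : (0 : ℝ) < ρ⁻¹)]
    have hi1 : (Real.sqrt ρ)⁻¹ ≤ 1 := inv_le_one_of_one_le₀ hsρ1
    calc (Real.sqrt ρ)⁻¹ * ρ⁻¹ * |deriv (cosTransform ψ) ρ⁻¹| * |ψ 1| ≤ 1 * 1 * K * |ψ 1| :=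
          mul_le_mul_of_nonneg_right (mul_le_mul (mul_le_mul hi1 hρi1 (by positivity) (by norm_num))
            (hη' _) (abs_nonneg _) (by norm_num)) (abs_nonneg _)
      _ = K * |ψ 1| := by ring
  · rw [scaleDeriv, abs_mul, abs_mul, abs_mul, abs_of_nonneg (Real.sqrt_nonneg _), abs_of_pos hρ0]
    exact mul_le_mul (mul_le_mul_of_nonneg_right hsρ (abs_nonneg _))
      (mul_le_mul hρ2 (hη' ρ) (abs_nonneg _) (by norm_num)) (by positivity) (by positivity)

/-- RH-FREE. The closing arithmetic of Lemma F.1 (i) WITHOUT (100): with `K = 99π/35`,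
`M₀ = 8n²+(12π+4)n+16π²+12π+3` and any endpoint bound `E ≥ 0` with `E² ≤ (27/4)(2n(2n+1) + 8π²)`
(then `E ≤ 6n + 12`), `2K(1.0001·M₀ + (134/35)E) ≤ 4π·p(n)·(39831/40000)` for `n ≥ 3` — the
`A_n`-part of the printed `p(n) = 16n² + …` against `M₀ = 8n² + …` leaves room quadratic in `n`
(coefficientwise, using `3.14 < π < 3.15`).
[cite: ConnesConsani2021, App. F Lemma F.1 (arXiv Lemma 49) proof, arXiv PDF p. 55 (chunk p0035:L88–L92)] -/
theorem termwise_arith_F {n : ℕ} (hn : 3 ≤ n) {E : ℝ} (hE0 : 0 ≤ E)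
    (hE : E ^ 2 ≤ 27 / 4 * (2 * (n : ℝ) * (2 * n + 1) + 8 * π ^ 2)) :
    2 * (99 * π / 35 * (9801 / 9800 * (8 * (n : ℝ) ^ 2 + (12 * π + 4) * n + 16 * π ^ 2 + 12 * π + 3)
      + 134 / 35 * E))
      ≤ 4 * π * remainderPoly n * (39831 / 40000) := by
  have hn' : (3 : ℝ) ≤ n := by exact_mod_cast hn
  have hπ := Real.pi_pos
  have h3 := Real.pi_gt_d2
  have h4 := Real.pi_lt_d2
  -- the endpoint bound is linear in `n`
  have hEB : E ≤ 6 * n + 12 := by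
    have hπ2 : π ^ 2 ≤ 3.15 ^ 2 := pow_le_pow_left₀ hπ.le h4.le 2
    have hB2 : 27 / 4 * (2 * (n : ℝ) * (2 * n + 1) + 8 * π ^ 2) ≤ (6 * n + 12) ^ 2 := by nlinarith
    have hB0 : (0 : ℝ) ≤ 6 * n + 12 := by positivity
    nlinarith [hE.trans hB2]
  set s : ℝ := Real.sqrt (2 * n + 1 / 2) with hs
  have hs0 : 0 ≤ s := Real.sqrt_nonneg _
  have hsq2 : Real.sqrt 2 ^ 2 = 2 := Real.sq_sqrt (by norm_num)
  have hsq2pos : 0 ≤ Real.sqrt 2 := Real.sqrt_nonneg 2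
  have hsS : Real.sqrt (4 * (n : ℝ) + 1) = Real.sqrt 2 * s := by
    rw [hs, ← Real.sqrt_mul (by norm_num)]; congr 1; ring
  have hp : remainderPoly n = 16 * (n : ℝ) ^ 2 + 8 * (1 + 3 * π) * n
      + (4 * (Real.sqrt 2 * s) + 2 * s) + 32 * π ^ 2 + 24 * π + 2 := by
    rw [remainderPoly, hsS]; linear_combination s * hsq2
  have hcore : 198 / 35 * (9801 / 9800 * (8 * (n : ℝ) ^ 2 + (12 * π + 4) * n + 16 * π ^ 2 + 12 * π + 3)
      + 134 / 35 * E) ≤ 39831 / 10000 * (16 * (n : ℝ) ^ 2 + 8 * (1 + 3 * π) * n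
      + (4 * (Real.sqrt 2 * s) + 2 * s) + 32 * π ^ 2 + 24 * π + 2) := by
    have hn2 : 3 * (n : ℝ) ≤ (n : ℝ) ^ 2 := by nlinarith
    have hπn : 3.14 * (n : ℝ) ≤ π * n := mul_le_mul_of_nonneg_right h3.le (by positivity)
    have hπ2 : 9.8596 ≤ π ^ 2 := by nlinarith
    have hss : 0 ≤ Real.sqrt 2 * s := mul_nonneg hsq2pos hs0
    nlinarith [hEB, hπn, hπ2, hss, hs0, hn2]
  rw [hp]
  have := mul_le_mul_of_nonneg_left hcore hπ.le
  linarith [this]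

/-- RH-FREE. **Lemma F.1, termwise form, for the §4-only datum — PROVED**: `|τ(n)T_n(ρ)| ≤ a(n)` for
`n ≥ 3`, `ρ ∈ [1,2]`, with NO [Rokhlin–Xiao] input: the chain of `CC2021_lemma_49_termwise_holds`
(`|η̃′| ≤ 99π/35`, `∫_{ρ⁻¹}^1|D_uψ| ≤ (99/280)(W₀+χ)`, proportionality, `λ² ≤ (13/200)²`) with the
boundary values bounded through [Bonami–Karoui 2014] (`abs_apply_one_sq_le`, `termwise_arith_F`).
[cite: ConnesConsani2021, App. F Lemma F.1 (i) (arXiv Lemma 49), arXiv PDF p. 55 (chunk p0035:L78–L92)]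
[cite: BonamiKaroui2014, Thm. 3.1] -/
theorem abs_sonineQTerm_le (d : IsAppFDatum n ψ lam χ) (hn : 3 ≤ n) {ρ : ℝ}
    (hρ : ρ ∈ Icc (1 : ℝ) 2) : |sonineQTerm ψ lam ρ| ≤ remainderTerm n := by
  obtain ⟨hρ1, hρ2⟩ := hρ
  have hπ := Real.pi_pos
  have hn' : (3 : ℝ) ≤ n := by exact_mod_cast hn
  have hS1 := d.abs_integralTerm_le_F hn hρ1 hρ2
  obtain ⟨hS2, hS3⟩ := d.abs_boundaryTerms_le_F hρ1 hρ2
  obtain ⟨hr, hlam2⟩ := d.abs_lam_le_const_F hn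
  have harith := termwise_arith_F hn (abs_nonneg (ψ 1)) (d.abs_apply_one_sq_le hn)
  have h1l : 0 < 1 - lam ^ 2 := by linarith [d.sq_lam_lt]
  have hp0 : 0 < remainderPoly n := remainderPoly_pos n
  have hK0 : 0 ≤ 99 * π / 35 := by positivity
  -- `W₀ + χ ≤ M₀`
  have hM : ((2 * (n : ℝ)) ^ 2 + (6 * π + 1) * (2 * n) + 3 * (2 * π + 1) ^ 2) + χ
      ≤ 8 * (n : ℝ) ^ 2 + (12 * π + 4) * n + 16 * π ^ 2 + 12 * π + 3 := by
    nlinarith [d.eigen_lt]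
  have hM' := mul_le_mul_of_nonneg_left hM (by positivity : (0 : ℝ) ≤ 99 * π / 35 * (9801 / 9800))
  have hlast : 4 * π * remainderPoly n * (39831 / 40000) ≤ 4 * π * remainderPoly n * (1 - lam ^ 2) :=
    mul_le_mul_of_nonneg_left (by linarith) (by positivity)
  have htri := (abs_sub (Real.sqrt ρ * (∫ x in ρ⁻¹..1, scaleDerivIn ψ x * scaleDeriv (cosTransform ψ) (ρ * x))
      + (Real.sqrt ρ)⁻¹ * scaleDerivIn ψ ρ⁻¹ * cosTransform ψ 1)
      (Real.sqrt ρ * ψ 1 * scaleDeriv (cosTransform ψ) ρ)).trans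
    (add_le_add (abs_add_le _ _) le_rfl)
  have hS : |Real.sqrt ρ * (∫ x in ρ⁻¹..1, scaleDerivIn ψ x * scaleDeriv (cosTransform ψ) (ρ * x))
        + (Real.sqrt ρ)⁻¹ * scaleDerivIn ψ ρ⁻¹ * cosTransform ψ 1
        - Real.sqrt ρ * ψ 1 * scaleDeriv (cosTransform ψ) ρ|
      ≤ 4 * π * remainderPoly n * (1 - lam ^ 2) / 2 := by
    linarith [htri, hS1, hS2, hS3, hM', harith, hlast]
  rw [sonineQTerm, abs_mul, abs_div, abs_mul, abs_two, abs_of_pos h1l]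
  calc 2 * |lam| / (1 - lam ^ 2) * _
      ≤ 2 * |lam| / (1 - lam ^ 2) * (4 * π * remainderPoly n * (1 - lam ^ 2) / 2) :=
        mul_le_mul_of_nonneg_left hS (by positivity)
    _ = |lam| * (4 * π * remainderPoly n) := by field_simp
    _ ≤ remainderTerm n / (4 * π * remainderPoly n) * (4 * π * remainderPoly n) :=
        mul_le_mul_of_nonneg_right hr (by positivity)
    _ = remainderTerm n := by field_simp

end IsAppFDatum

/-! ## (computersafe) and (computersafe1) for §4-only data -/

/-- RH-FREE. **Lemma F.1 (i) = (computersafe)** for §4-only data (`N ≥ 2`): `Σ_{n>N} τ(n)T_n(ρ)`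
converges absolutely and `|Σ_{n>N} τ(n)T_n(ρ)| ≤ Σ_{n>N} a(n)` for `ρ ∈ [1,2]` — no [Rokhlin–Xiao] or
[Wang] hypothesis. [cite: ConnesConsani2021, App. F Lemma F.1 (i) (arXiv Lemma 49) eq. (computersafe), arXiv PDF p. 55 (chunk p0035:L78–L81)] -/
theorem lemma_49_i_F {N : ℕ} (hN : 2 ≤ N) {ψ : ℕ → ℝ → ℝ} {lam χ : ℕ → ℝ}
    (hd : ∀ n, N < n → IsAppFDatum n (ψ n) (lam n) (χ n)) {ρ : ℝ} (hρ : ρ ∈ Icc (1 : ℝ) 2) :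
    Summable (fun k : ℕ ↦ sonineQTerm (ψ (k + (N + 1))) (lam (k + (N + 1))) ρ) ∧
      |∑' k : ℕ, sonineQTerm (ψ (k + (N + 1))) (lam (k + (N + 1))) ρ|
        ≤ ∑' k : ℕ, remainderTerm (k + (N + 1)) := by
  have hb : ∀ k : ℕ, ‖sonineQTerm (ψ (k + (N + 1))) (lam (k + (N + 1))) ρ‖
      ≤ remainderTerm (k + (N + 1)) := fun k ↦ by
    rw [Real.norm_eq_abs]
    exact (hd _ (by omega)).abs_sonineQTerm_le (by omega) hρ
  have hs : Summable (fun k : ℕ ↦ remainderTerm (k + (N + 1))) :=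
    (summable_nat_add_iff (N + 1)).2 summable_remainderTerm
  refine ⟨Summable.of_norm_bounded hs hb, ?_⟩
  rw [← Real.norm_eq_abs]
  exact tsum_of_norm_bounded hs.hasSum hb

/-- RH-FREE. **Lemma F.1 (ii) = (computersafe1)** for §4-only data: `|Σ_{n≥11} τ(n)T_n(ρ)| ≤ 2.366·10^{-12}`
for `ρ ∈ [1,2]` (the number certified in kernel arithmetic, `CC2021_lemma_49_ii_tail_holds`).
[cite: ConnesConsani2021, App. F Lemma F.1 (ii) (arXiv Lemma 49) eq. (computersafe1), arXiv PDF p. 55 (chunk p0035:L82–L85)] -/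
theorem lemma_49_ii_F {ψ : ℕ → ℝ → ℝ} {lam χ : ℕ → ℝ}
    (hd : ∀ n, 10 < n → IsAppFDatum n (ψ n) (lam n) (χ n)) {ρ : ℝ} (hρ : ρ ∈ Icc (1 : ℝ) 2) :
    Summable (fun k : ℕ ↦ sonineQTerm (ψ (k + 11)) (lam (k + 11)) ρ) ∧
      |∑' k : ℕ, sonineQTerm (ψ (k + 11)) (lam (k + 11)) ρ| ≤ (2.366e-12 : ℝ) := by
  obtain ⟨hs, hb⟩ := lemma_49_i_F (N := 10) (by norm_num) hd hρ
  exact ⟨hs, hb.trans CC2021_lemma_49_ii_tail_holds⟩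

/-! ## App. F for THE prolate sequence from the §4 facts alone -/

/-- RH-FREE. **The §4-only App. F datum of THE prolate vectors**: from (cosalphan)
`CC2021_sec4_cosalphan`, `|λ(n)| < 1` (`CC2021_sec4_lambda_basic`) and (rapid-decay)
`CC2021_sec4_rapidDecay`, `(prolateFun n, prolateEigen n, χ_{2n}^{2π})` is an `IsAppFDatum` — no
[Rokhlin–Xiao 2007, Thm 12], no [Wang 2010] hypothesis.
[cite: ConnesConsani2021, Prop. 4.5 (i) §4 (arXiv item 25, chunk p0016:L50); App. F (arXiv chunk p0035:L7–L20)] -/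
theorem exists_isAppFDatum_prolateFun (hcos : CC2021_sec4_cosalphan)
    (hbasic : CC2021_sec4_lambda_basic) (hrapid : CC2021_sec4_rapidDecay) (n : ℕ) :
    ∃ χ : ℝ, IsAppFDatum n (prolateFun n) (prolateEigen n) χ := by
  have hψ := isProlateFunction_prolateFun n
  obtain ⟨χ, hχ⟩ := hψ.eigen
  refine ⟨χ, ?_⟩
  have hψc : ContinuousOn (prolateFun n) (Icc (-1) 1) := by
    simpa using hψ.contDiffOn.continuousOn
  exact
    { isProlate := hψ
      eigen := hχ
      cosTransform_eq := fun x hx ↦ by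
        rw [cosTransform_eq_re_fourier hψc, hcos n x hx, Complex.re_ofReal_mul, Complex.ofReal_re]
      sq_lam_lt := by
        have h1 := hbasic.2.1 n
        have h0 := abs_nonneg (prolateEigen n)
        nlinarith [sq_abs (prolateEigen n)]
      abs_lam_le := by
        have h := hrapid.1 n
        rw [rokhlinXiaoBound] at h
        convert h using 1
        ring }

/-- RH-FREE. **Lemma F.1 termwise for THE series, [Rokhlin–Xiao]-free**: for `n ≥ 3`, `ρ ∈ [1,2]`,
`|τ(n)T_n(ρ)| ≤ a(n)`, conditional on the three §4 named facts only.
[cite: ConnesConsani2021, App. F Lemma F.1 (i) (arXiv Lemma 49), arXiv PDF p. 55 (chunk p0035:L87–L92)] -/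
theorem sonineQTerm_prolateFun_le_rokhlinFree (hcos : CC2021_sec4_cosalphan)
    (hbasic : CC2021_sec4_lambda_basic) (hrapid : CC2021_sec4_rapidDecay) {n : ℕ} (hn : 3 ≤ n)
    {ρ : ℝ} (hρ : ρ ∈ Icc (1 : ℝ) 2) :
    |sonineQTerm (prolateFun n) (prolateEigen n) ρ| ≤ remainderTerm n := by
  obtain ⟨χ, d⟩ := exists_isAppFDatum_prolateFun hcos hbasic hrapid n
  exact d.abs_sonineQTerm_le hn hρ

/-- RH-FREE. **Lemma F.1 (i) = (computersafe) for THE series, [Rokhlin–Xiao]-free** (`N ≥ 2`):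
absolute convergence and `|Σ_{n>N} τ(n)T_n(ρ)| ≤ Σ_{n>N} a(n)` on `[1,2]`, conditional on the three §4
named facts `CC2021_sec4_cosalphan`, `CC2021_sec4_lambda_basic`, `CC2021_sec4_rapidDecay` only.
[cite: ConnesConsani2021, App. F Lemma F.1 (i) (arXiv Lemma 49) eq. (computersafe), arXiv PDF p. 55 (chunk p0035:L78–L81)] -/
theorem lemma_49_i_prolateFun_rokhlinFree (hcos : CC2021_sec4_cosalphan)
    (hbasic : CC2021_sec4_lambda_basic) (hrapid : CC2021_sec4_rapidDecay) {N : ℕ} (hN : 2 ≤ N)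
    {ρ : ℝ} (hρ : ρ ∈ Icc (1 : ℝ) 2) :
    Summable (fun k : ℕ ↦ sonineQTerm (prolateFun (k + (N + 1))) (prolateEigen (k + (N + 1))) ρ) ∧
      |∑' k : ℕ, sonineQTerm (prolateFun (k + (N + 1))) (prolateEigen (k + (N + 1))) ρ|
        ≤ ∑' k : ℕ, remainderTerm (k + (N + 1)) := by
  choose χ hχ using exists_isAppFDatum_prolateFun hcos hbasic hrapid
  exact lemma_49_i_F hN (fun n _ ↦ hχ n) hρ

/-- RH-FREE. **Lemma F.1 (ii) = (computersafe1) for THE series, [Rokhlin–Xiao]-free**: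
`|Σ_{n≥11} τ(n)T_n(ρ)| ≤ 2.366·10^{-12}` on `[1,2]`, conditional on the three §4 named facts only.
[cite: ConnesConsani2021, App. F Lemma F.1 (ii) (arXiv Lemma 49) eq. (computersafe1), arXiv PDF p. 55 (chunk p0035:L82–L85)] -/
theorem lemma_49_ii_prolateFun_rokhlinFree (hcos : CC2021_sec4_cosalphan)
    (hbasic : CC2021_sec4_lambda_basic) (hrapid : CC2021_sec4_rapidDecay) {ρ : ℝ}
    (hρ : ρ ∈ Icc (1 : ℝ) 2) :
    Summable (fun k : ℕ ↦ sonineQTerm (prolateFun (k + 11)) (prolateEigen (k + 11)) ρ) ∧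
      |∑' k : ℕ, sonineQTerm (prolateFun (k + 11)) (prolateEigen (k + 11)) ρ| ≤ (2.366e-12 : ℝ) := by
  choose χ hχ using exists_isAppFDatum_prolateFun hcos hbasic hrapid
  exact lemma_49_ii_F (fun n _ ↦ hχ n) hρ

end Literature.NumberTheory.ConnesConsani2021
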